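import Mathlib.Tactic
import HarnessLib
import HarnessLib.Audit.Tags
import Summits.CriticalPhenomena.PercolationContinuityZ3.Theorems.PercNearOneGluingNoHeavyLowerTailSahiAntichainSplitTwoThree
import Summits.CriticalPhenomena.PercolationContinuityZ3.Theorems.PercNearOneGluingNoHeavyLowerTailSahiAntichainSplitThreeTwo

/-!
# Antichains, meets plus joins: five members have nine labels; V5 unconditionally for at most eight members

Support file (seat `prim-masterthm-p1`, gen 36; `--supports stmt-CriticalPhenomena-4575`).  No `sorry`, no new definitions, standard
axioms.  Memo `run/shared/lean/prim/prim-masterthm/FROM-prim-masterthm-p1-g36-DUALITY-PROJECTION-SUNFLOWER.md` §7.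

SETTING (files `…SahiAntichainSplit*`): V5 says an antichain has `2 #P ≤ #meets P + #joins P + 2`; `…SplitSeven` proved it for
`#P ≤ 7` together with «four members ⟹ seven labels».

NEW HERE ([this work], gen 36).
* `nine_le_of_card_eq_five`: **every five-member antichain has `#meets + #joins ≥ 9`** (exhaustive data: ≥ 10).  At an effective point
  the split is `1 + 4` / `4 + 1` (seven labels on the four-side plus two new ones from the one-sided step), or `2 + 3` / `3 + 2`:
  a (co)sunflower three-side gives three new labels (`…SplitTwoThree`, `…SplitThreeTwo`), any other three-side has five labels of
  its own and the two-member step gives two new ones.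
* `two_mul_card_le_of_card_le_eight`: **V5 for every antichain with at most eight members**, unconditionally: the new splits are
  `3 + 5` / `5 + 3` (a (co)sunflower three-side is a good point; otherwise `5 + 9 = 14` labels) and `4 + 4` (`7 + 7`).  V1 follows.
HONEST FRAMING: V5 for `#P ≥ 9` remains OPEN (a `3 + 6` split with a `C([4],2)`-type six-side and no new label would have only
`5 + 10 = 15 < 16` labels, so the next case needs a new label there). [this work]
-/

namespace Summit.CriticalPhenomena.PercolationContinuityZ3.Theorems.SahiColouredDaykin

open Finset

variable {α : Type*} [DecidableEq α]

/-- **Every five-member antichain has at least nine labels.** [this work] -/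
theorem nine_le_of_card_eq_five {P : Finset (Finset α)} (hanti : IsAntichain (· ⊆ ·) (P : Set (Finset α))) (h5 : #P = 5) :
    9 ≤ #(meets P) + #(joins P) := by
  obtain ⟨r, hr⟩ := effPoints_nonempty (by omega : 2 ≤ #P)
  obtain ⟨hA, hB⟩ := mem_effPoints_iff.1 hr
  have hcard := card_above_add_card_below P r
  have hApos : 0 < #(above P r) := card_pos.2 hA
  have hBpos : 0 < #(below P r) := card_pos.2 hB
  have hsplit := card_meets_add_card_joins_split P r
  have hantiA := isAntichain_above hanti r
  have hantiB := isAntichain_below hanti r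
  have vA := two_mul_card_le_of_card_le_seven (above P r) hantiA (by omega)
  have vB := two_mul_card_le_of_card_le_seven (below P r) hantiB (by omega)
  unfold newLabels at hsplit
  by_cases hA1 : #(above P r) = 1
  · have h7 := seven_le_of_card_eq_four hantiB (by omega)
    have h2 := two_le_newLabels_of_card_above_eq_one hanti (by omega) hA1
    unfold newLabels at h2; omega
  by_cases hB1 : #(below P r) = 1
  · have h7 := seven_le_of_card_eq_four hantiA (by omega)
    have h2 := two_le_newLabels_of_card_below_eq_one hanti (by omega) hB1
    unfold newLabels at h2; omega
  by_cases hA2 : #(above P r) = 2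
  · have hB3 : #(below P r) = 3 := by omega
    rcases three_members_trichotomy hantiB hB3 with ⟨K, hK⟩ | ⟨U, hU⟩ | hB5
    · have h3 := three_le_newLabels_of_two_sunflower_three hanti hA2 hB3 hK
      unfold newLabels at h3; omega
    · have h3 := three_le_newLabels_of_two_cosunflower_three hanti hA2 hB3 hU
      unfold newLabels at h3; omega
    · have h2 := two_le_newLabels_of_min_le_two hanti hA hB (Or.inl (by omega))
      unfold newLabels at h2; omega
  · have hA3 : #(above P r) = 3 := by omega
    have hB2 : #(below P r) = 2 := by omega
    rcases three_members_trichotomy hantiA hA3 with ⟨K, hK⟩ | ⟨U, hU⟩ | hA5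
    · have h3 := three_le_newLabels_of_sunflower_three_two hanti hA3 hB2 hK
      unfold newLabels at h3; omega
    · have h3 := three_le_newLabels_of_cosunflower_three_two hanti hA3 hB2 hU
      unfold newLabels at h3; omega
    · have h2 := two_le_newLabels_of_min_le_two hanti hA hB (Or.inr (by omega))
      unfold newLabels at h2; omega

/-- **V5 holds unconditionally for antichains with at most eight members.** [this work] -/
theorem two_mul_card_le_of_card_le_eight :
    ∀ P : Finset (Finset α), IsAntichain (· ⊆ ·) (P : Set (Finset α)) → #P ≤ 8 → 2 * #P ≤ #(meets P) + #(joins P) + 2 := by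
  intro P hanti h8
  by_cases h7 : #P ≤ 7
  · exact two_mul_card_le_of_card_le_seven P hanti h7
  have hP8 : #P = 8 := by omega
  obtain ⟨r, hr⟩ := effPoints_nonempty (by omega : 2 ≤ #P)
  obtain ⟨hA, hB⟩ := mem_effPoints_iff.1 hr
  have hcard := card_above_add_card_below P r
  have hApos : 0 < #(above P r) := card_pos.2 hA
  have hBpos : 0 < #(below P r) := card_pos.2 hB
  have hantiA := isAntichain_above hanti r
  have hantiB := isAntichain_below hanti r
  have ihA := two_mul_card_le_of_card_le_seven (above P r) hantiA (by omega)
  have ihB := two_mul_card_le_of_card_le_seven (below P r) hantiB (by omega)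
  by_cases hmin : #(above P r) ≤ 2 ∨ #(below P r) ≤ 2
  · exact two_mul_card_le_step P r (two_le_newLabels_of_min_le_two hanti hA hB hmin) ihA ihB
  push Not at hmin
  have hsplit := card_meets_add_card_joins_split P r
  by_cases hA3 : #(above P r) = 3
  · rcases three_members_trichotomy hantiA hA3 with ⟨K, hK⟩ | ⟨U, hU⟩ | hA5
    · exact two_mul_card_le_step P r (two_le_newLabels_of_above_sunflower hanti (by omega) hB hK) ihA ihB
    · exact two_mul_card_le_step P r (two_le_newLabels_of_above_cosunflower hanti (by omega) hB hU) ihA ihB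
    · have h9 := nine_le_of_card_eq_five hantiB (by omega)
      unfold newLabels at hsplit; omega
  by_cases hB3 : #(below P r) = 3
  · rcases three_members_trichotomy hantiB hB3 with ⟨K, hK⟩ | ⟨U, hU⟩ | hB5
    · exact two_mul_card_le_step P r (two_le_newLabels_of_below_sunflower hanti (by omega) hA hK) ihA ihB
    · exact two_mul_card_le_step P r (two_le_newLabels_of_below_cosunflower hanti (by omega) hA hU) ihA ihB
    · have h9 := nine_le_of_card_eq_five hantiA (by omega)
      unfold newLabels at hsplit; omega
  · -- the 4 + 4 split
    have hA4 : #(above P r) = 4 := by omega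
    have hB4 : #(below P r) = 4 := by omega
    have h7A := seven_le_of_card_eq_four hantiA hA4
    have h7B := seven_le_of_card_eq_four hantiB hB4
    unfold newLabels at hsplit; omega

/-- V1 for at most eight members, unconditionally. [this work] -/
theorem card_le_or_card_le_of_card_le_eight (P : Finset (Finset α)) (hanti : IsAntichain (· ⊆ ·) (P : Set (Finset α)))
    (h8 : #P ≤ 8) : #P ≤ #(meets P) + 1 ∨ #P ≤ #(joins P) + 1 :=
  card_le_or_card_le_of_two_mul_card_le (two_mul_card_le_of_card_le_eight P hanti h8)

end Summit.CriticalPhenomena.PercolationContinuityZ3.Theorems.SahiColouredDaykin
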